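import Summits.AtomisticToContinuum.FouriersLaw.Theorems.ParityLiouvilleSeedWindowLimitWeakLimit
import Summits.AtomisticToContinuum.FouriersLaw.Theorems.ParityLiouvilleSeedWindowLimitCurrents
import Summits.AtomisticToContinuum.FouriersLaw.Theorems.ParityLiouvilleSeedCesaroUpgradeGrowth

/-!
# Moments and mean current of a window limit (helper for `WindowLimit`)

Helper file for the route item `ParityLiouvilleSeed.WindowLimit` (`stmt-AtomisticToContinuum-13982`).
For a family `μ_N` of probability measures on the `N`-chain phase spaces with site-uniform moments of all
orders and a weakly convergent sequence of centred window measures `windowPM (μ (Nk k)) → ν`: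

* `tendsto_integral_window` — every continuous observable of the infinite chain dominated by
  `A + B ∑_{z ∈ s} (|q_z|^m + |p_z|^m)` (finitely many sites) is `ν`-integrable and its window averages
  converge (`tendsto_integral_of_tendsto_of_sq_le` with the squared weight, which is again of that form);
* `moments_of_window_limit` — `ν` is translation-BOUNDED: all site moments bounded uniformly in the site;
* `current_of_window_limit` — `j₀ ∈ L¹(ν)` (continuity from `CesaroUpgrade.continuous_pinnedChain_bondCurrentZ`) and the centre
  currents `centreCurrent (μ (Nk k))` converge to `∫ j₀ dν` (pinned chain, ARBITRARY real parameters,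
  lengths `Nk → ∞`).

Nothing here closes an item.
-/

noncomputable section

namespace Summit.AtomisticToContinuum.FouriersLaw.Theorems.WindowLimit

open MeasureTheory Filter Topology Set
open scoped ENNReal
open Literature.MathematicalPhysics.KineticTheory
open Literature.MathematicalPhysics.KineticTheory.HeatConduction

/-! ### Site weights -/

/-- The site weight `∑_{z ∈ s} (|q_z|^m + |p_z|^m)` is continuous on configurations. [folklore] -/
theorem continuous_siteWeight (s : Finset ℤ) (m : ℕ) :
    Continuous fun σ : ChainConfig => ∑ z ∈ s, (|(σ z).1| ^ m + |(σ z).2| ^ m) :=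
  continuous_finsetSum _ fun z _ =>
    ((continuous_abs.comp (continuous_fst.comp (continuous_apply z))).pow m).add
      ((continuous_abs.comp (continuous_snd.comp (continuous_apply z))).pow m)

/-- `(∑_{z∈s} (|q_z|^m + |p_z|^m))² ≤ 2|s| ∑_{z∈s} (|q_z|^{2m} + |p_z|^{2m})`. [folklore] -/
theorem siteWeight_sq_le (s : Finset ℤ) (m : ℕ) (σ : ChainConfig) :
    (∑ z ∈ s, (|(σ z).1| ^ m + |(σ z).2| ^ m)) ^ 2 ≤
      2 * s.card * ∑ z ∈ s, (|(σ z).1| ^ (2 * m) + |(σ z).2| ^ (2 * m)) := by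
  have h1 := sq_sum_le_card_mul_sum_sq (s := s) (f := fun z => |(σ z).1| ^ m + |(σ z).2| ^ m)
  have h2 : ∑ z ∈ s, (|(σ z).1| ^ m + |(σ z).2| ^ m) ^ 2 ≤
      ∑ z ∈ s, 2 * (|(σ z).1| ^ (2 * m) + |(σ z).2| ^ (2 * m)) := by
    refine Finset.sum_le_sum fun z _ => ?_
    have e1 : |(σ z).1| ^ (2 * m) = (|(σ z).1| ^ m) ^ 2 := by rw [pow_mul']
    have e2 : |(σ z).2| ^ (2 * m) = (|(σ z).2| ^ m) ^ 2 := by rw [pow_mul']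
    rw [e1, e2]
    nlinarith [sq_nonneg (|(σ z).1| ^ m - |(σ z).2| ^ m)]
  calc _ ≤ (s.card : ℝ) * ∑ z ∈ s, (|(σ z).1| ^ m + |(σ z).2| ^ m) ^ 2 := h1
    _ ≤ (s.card : ℝ) * ∑ z ∈ s, 2 * (|(σ z).1| ^ (2 * m) + |(σ z).2| ^ (2 * m)) :=
        mul_le_mul_of_nonneg_left h2 (Nat.cast_nonneg _)
    _ = 2 * s.card * ∑ z ∈ s, (|(σ z).1| ^ (2 * m) + |(σ z).2| ^ (2 * m)) := by
        rw [← Finset.mul_sum]; ring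

variable {ω₂ lam β γ T_L T_R : ℝ}

/-- Uniform bound for the site weights under all window measures. [folklore] -/
theorem integral_siteWeight_window_le (μ : (N : ℕ) → Measure (PhaseSpace N))
    (hprob : ∀ N, IsProbabilityMeasure (μ N))
    (hmom : ∀ m : ℕ, ∃ C : ℝ, ∀ (N : ℕ) (i : Fin N),
      Integrable (fun x : PhaseSpace N => |x.1 i| ^ m + |x.2 i| ^ m) (μ N) ∧
        ∫ x, (|x.1 i| ^ m + |x.2 i| ^ m) ∂(μ N) ≤ C) (s : Finset ℤ) (m : ℕ) :
    ∃ C' : ℝ, 0 ≤ C' ∧ ∀ (N c : ℕ),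
      Integrable (fun σ : ChainConfig => ∑ z ∈ s, (|(σ z).1| ^ m + |(σ z).2| ^ m)) ((μ N).map (embed N c)) ∧
        ∫ σ, (∑ z ∈ s, (|(σ z).1| ^ m + |(σ z).2| ^ m)) ∂((μ N).map (embed N c)) ≤ s.card * C' := by
  obtain ⟨C', hC'0, hC'⟩ := site_moment_window_le μ hprob hmom m
  refine ⟨C', hC'0, fun N c => ?_⟩
  have hint : Integrable (fun σ : ChainConfig => ∑ z ∈ s, (|(σ z).1| ^ m + |(σ z).2| ^ m)) ((μ N).map (embed N c)) :=
    integrable_finsetSum _ fun z _ => (hC' N c z).1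
  refine ⟨hint, ?_⟩
  rw [integral_finsetSum _ fun z _ => (hC' N c z).1]
  calc ∑ z ∈ s, ∫ σ, (|(σ z).1| ^ m + |(σ z).2| ^ m) ∂((μ N).map (embed N c)) ≤ ∑ _z ∈ s, C' :=
        Finset.sum_le_sum fun z _ => (hC' N c z).2
    _ = s.card * C' := by rw [Finset.sum_const, nsmul_eq_mul]

/-! ### Transfer of window averages -/

/-- **Transfer of window averages to the window limit.** If the centred window measures of
`μ (Nk k)` converge weakly to `ν` and `h` is a continuous observable of the infinite chain with
`|h| ≤ A + B ∑_{z∈s} (|q_z|^m + |p_z|^m)`, then `h ∈ L¹(ν)` and `∫ h ∘ embed dμ_{Nk k} → ∫ h dν`. [folklore] -/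
theorem tendsto_integral_window (μ : (N : ℕ) → Measure (PhaseSpace N)) (hprob : ∀ N, IsProbabilityMeasure (μ N))
    (hmom : ∀ m : ℕ, ∃ C : ℝ, ∀ (N : ℕ) (i : Fin N),
      Integrable (fun x : PhaseSpace N => |x.1 i| ^ m + |x.2 i| ^ m) (μ N) ∧
        ∫ x, (|x.1 i| ^ m + |x.2 i| ^ m) ∂(μ N) ≤ C)
    {Nk : ℕ → ℕ} {ν : Measure ChainConfig} [IsProbabilityMeasure ν]
    (hlim : Tendsto (fun k => (haveI := hprob (Nk k); windowPM (μ (Nk k)))) atTop (𝓝 (toPM ν)))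
    {h : ChainConfig → ℝ} (hh : Continuous h) (s : Finset ℤ) (m : ℕ) {A B : ℝ}
    (hbd : ∀ σ, |h σ| ≤ A + B * ∑ z ∈ s, (|(σ z).1| ^ m + |(σ z).2| ^ m)) :
    Integrable h ν ∧
      Tendsto (fun k => ∫ x, h (embed (Nk k) (Nk k / 2) x) ∂(μ (Nk k))) atTop (𝓝 (∫ σ, h σ ∂ν)) := by
  obtain ⟨C', hC'0, hC'⟩ := integral_siteWeight_window_le μ hprob hmom s (2 * m)
  set W : ChainConfig → ℝ := fun σ => ∑ z ∈ s, (|(σ z).1| ^ m + |(σ z).2| ^ m) with hW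
  set W2 : ChainConfig → ℝ := fun σ => ∑ z ∈ s, (|(σ z).1| ^ (2 * m) + |(σ z).2| ^ (2 * m)) with hW2
  set G : ChainConfig → ℝ := fun σ => A + B * W σ with hG
  have hWc : Continuous W := continuous_siteWeight s m
  have hGc : Continuous G := continuous_const.add (continuous_const.mul hWc)
  have hW0 : ∀ σ, 0 ≤ W σ := fun σ => Finset.sum_nonneg fun z _ => by positivity
  -- `G² ≤ 2A² + 4B²|s| W₂`
  have hG2 : ∀ σ, G σ ^ 2 ≤ 2 * A ^ 2 + 4 * B ^ 2 * s.card * W2 σ := by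
    intro σ
    have h1 : G σ ^ 2 ≤ 2 * A ^ 2 + 2 * (B * W σ) ^ 2 := by
      rw [hG]; nlinarith [sq_nonneg (A - B * W σ)]
    have h2 : (B * W σ) ^ 2 ≤ B ^ 2 * (2 * s.card * W2 σ) := by
      rw [mul_pow]; exact mul_le_mul_of_nonneg_left (siteWeight_sq_le s m σ) (sq_nonneg _)
    nlinarith
  set M : ℝ := 2 * A ^ 2 + 4 * B ^ 2 * s.card * (s.card * C') with hM
  have hdom_int : ∀ N c, Integrable (fun σ => G σ ^ 2) ((μ N).map (embed N c)) ∧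
      ∫ σ, G σ ^ 2 ∂((μ N).map (embed N c)) ≤ M := by
    intro N c
    haveI := hprob N
    haveI : IsProbabilityMeasure ((μ N).map (embed N c)) := isProbabilityMeasure_map_embed c (μ N)
    obtain ⟨hW2i, hW2le⟩ := hC' N c
    have hbd_i : Integrable (fun σ => 2 * A ^ 2 + 4 * B ^ 2 * s.card * W2 σ) ((μ N).map (embed N c)) :=
      (integrable_const _).add (hW2i.const_mul _)
    have hGi : Integrable (fun σ => G σ ^ 2) ((μ N).map (embed N c)) :=
      hbd_i.mono' (hGc.pow 2).aestronglyMeasurable (Eventually.of_forall fun σ => by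
        rw [Real.norm_eq_abs, abs_of_nonneg (sq_nonneg _)]; exact hG2 σ)
    refine ⟨hGi, ?_⟩
    calc ∫ σ, G σ ^ 2 ∂((μ N).map (embed N c)) ≤ ∫ σ, (2 * A ^ 2 + 4 * B ^ 2 * s.card * W2 σ) ∂((μ N).map (embed N c)) :=
          integral_mono hGi hbd_i fun σ => hG2 σ
      _ = 2 * A ^ 2 + 4 * B ^ 2 * s.card * ∫ σ, W2 σ ∂((μ N).map (embed N c)) := by
          rw [integral_add (integrable_const _) (hW2i.const_mul _), integral_const, probReal_univ, one_smul,
            integral_const_mul]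
      _ ≤ M := by
          rw [hM]
          have : 0 ≤ 4 * B ^ 2 * (s.card : ℝ) := by positivity
          nlinarith [mul_le_mul_of_nonneg_left hW2le this]
  -- apply the abstract transfer lemma
  have key := tendsto_integral_of_tendsto_of_sq_le (X := ChainConfig)
    (κs := fun k => (haveI := hprob (Nk k); windowPM (μ (Nk k)))) (κ := toPM ν) hlim hh hGc
    (fun σ => hbd σ) (M := M)
    (fun k => by haveI := hprob (Nk k); rw [coe_windowPM]; exact (hdom_int _ _).1)
    (fun k => by haveI := hprob (Nk k); rw [coe_windowPM]; exact (hdom_int _ _).2)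
  rw [coe_toPM] at key
  refine ⟨key.1, ?_⟩
  refine key.2.congr fun k => ?_
  haveI := hprob (Nk k)
  rw [coe_windowPM, integral_map (measurable_embed _ _).aemeasurable hh.aestronglyMeasurable]

/-! ### The window limit is translation-bounded -/

/-- **Site moments of a window limit**: all polynomial site moments of `ν` are bounded uniformly in the
site (by the site-uniform constants of the family). [folklore] -/
theorem moments_of_window_limit (μ : (N : ℕ) → Measure (PhaseSpace N)) (hprob : ∀ N, IsProbabilityMeasure (μ N))
    (hmom : ∀ m : ℕ, ∃ C : ℝ, ∀ (N : ℕ) (i : Fin N),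
      Integrable (fun x : PhaseSpace N => |x.1 i| ^ m + |x.2 i| ^ m) (μ N) ∧
        ∫ x, (|x.1 i| ^ m + |x.2 i| ^ m) ∂(μ N) ≤ C)
    {Nk : ℕ → ℕ} {ν : Measure ChainConfig} [IsProbabilityMeasure ν]
    (hlim : Tendsto (fun k => (haveI := hprob (Nk k); windowPM (μ (Nk k)))) atTop (𝓝 (toPM ν))) (m : ℕ) :
    ∃ C : ℝ, ∀ x : ℤ, Integrable (fun σ : ChainConfig => |(σ x).1| ^ m + |(σ x).2| ^ m) ν ∧
      ∫ σ, (|(σ x).1| ^ m + |(σ x).2| ^ m) ∂ν ≤ C := by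
  obtain ⟨C', -, hC'⟩ := site_moment_window_le μ hprob hmom m
  refine ⟨C', fun x => ?_⟩
  have hcont : Continuous fun σ : ChainConfig => |(σ x).1| ^ m + |(σ x).2| ^ m := by
    simpa using continuous_siteWeight {x} m
  have hbd : ∀ σ : ChainConfig, |(|(σ x).1| ^ m + |(σ x).2| ^ m)| ≤
      0 + 1 * ∑ z ∈ ({x} : Finset ℤ), (|(σ z).1| ^ m + |(σ z).2| ^ m) := fun σ => by
    rw [Finset.sum_singleton, zero_add, one_mul, abs_of_nonneg (by positivity)]
  obtain ⟨hint, hconv⟩ := tendsto_integral_window μ hprob hmom hlim hcont {x} m hbd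
  refine ⟨hint, le_of_tendsto' hconv fun k => ?_⟩
  haveI := hprob (Nk k)
  have h := (hC' (Nk k) (Nk k / 2) x).2
  rwa [integral_map (measurable_embed _ _).aemeasurable hcont.aestronglyMeasurable] at h

/-! ### The mean current of the window limit -/

/-- **Moment bound for `j₀`** in the site-weight form: `|j₀(σ)| ≤ 4(1+6|β|) + 2(1+6|β|) ∑_{z∈{0,1}} (|q_z|⁴ + |p_z|⁴)`.
[folklore] -/
theorem abs_pinnedChain_bondCurrentZ_zero_le (ω₂ lam β γ : ℝ) (σ : ChainConfig) :
    |(pinnedChain ω₂ lam β γ).bondCurrentZ σ 0| ≤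
      4 * (1 + 6 * |β|) + 2 * (1 + 6 * |β|) * ∑ z ∈ ({0, 1} : Finset ℤ), (|(σ z).1| ^ 4 + |(σ z).2| ^ 4) := by
  have h := abs_bondCurrent_term_le β (σ 0).2 (σ 1).2 (σ 0).1 (σ 1).1
  have e : (pinnedChain ω₂ lam β γ).bondCurrentZ σ 0 =
      -(((σ 0).2 + (σ 1).2) / 2 * ((σ 1).1 - (σ 0).1 + β * ((σ 1).1 - (σ 0).1) ^ 3)) := by
    simp only [OscillatorChain.bondCurrentZ, pinnedChain_deriv_V, zero_add]
  rw [e, abs_neg]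
  refine h.trans ?_
  rw [Finset.sum_pair (by norm_num : (0 : ℤ) ≠ 1)]
  have a1 : ∀ t : ℝ, |t| ^ 2 ≤ 1 + |t| ^ 4 := fun t => by nlinarith [sq_nonneg (|t| ^ 2 - 1), abs_nonneg t]
  have hc : 0 ≤ 1 + 6 * |β| := by positivity
  nlinarith [a1 (σ 0).1, a1 (σ 0).2, a1 (σ 1).1, a1 (σ 1).2, hc,
    mul_nonneg hc (by positivity : (0:ℝ) ≤ |(σ 0).1| ^ 4 + |(σ 0).2| ^ 4 + (|(σ 1).1| ^ 4 + |(σ 1).2| ^ 4))]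

/-- **The mean current passes to the window limit.** For the pinned chain with ARBITRARY real parameters,
a family of probability measures with site-uniform moments, lengths `Nk → ∞` and a weak limit `ν` of the
centred window measures: `j₀ ∈ L¹(ν)` and `centreCurrent (μ (Nk k)) → ∫ j₀ dν`. [folklore] -/
theorem current_of_window_limit (μ : (N : ℕ) → Measure (PhaseSpace N)) (hprob : ∀ N, IsProbabilityMeasure (μ N))
    (hmom : ∀ m : ℕ, ∃ C : ℝ, ∀ (N : ℕ) (i : Fin N),
      Integrable (fun x : PhaseSpace N => |x.1 i| ^ m + |x.2 i| ^ m) (μ N) ∧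
        ∫ x, (|x.1 i| ^ m + |x.2 i| ^ m) ∂(μ N) ≤ C)
    {Nk : ℕ → ℕ} (hNk : Tendsto Nk atTop atTop) {ν : Measure ChainConfig} [IsProbabilityMeasure ν]
    (hlim : Tendsto (fun k => (haveI := hprob (Nk k); windowPM (μ (Nk k)))) atTop (𝓝 (toPM ν))) :
    Integrable (fun σ => (pinnedChain ω₂ lam β γ).bondCurrentZ σ 0) ν ∧
      Tendsto (fun k => centreCurrent (pinnedChain ω₂ lam β γ) (μ (Nk k))) atTop
        (𝓝 (∫ σ, (pinnedChain ω₂ lam β γ).bondCurrentZ σ 0 ∂ν)) := by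
  set P := pinnedChain ω₂ lam β γ with hP
  obtain ⟨hint, hconv⟩ := tendsto_integral_window μ hprob hmom hlim (CesaroUpgrade.continuous_pinnedChain_bondCurrentZ ω₂ lam β γ 0)
    {0, 1} 4 (abs_pinnedChain_bondCurrentZ_zero_le ω₂ lam β γ)
  refine ⟨hint, hconv.congr' ?_⟩
  filter_upwards [hNk.eventually_ge_atTop 3] with k hk
  have hN0 : 0 < Nk k := by omega
  have hc : Nk k / 2 + 1 < Nk k := by omega
  rw [centreCurrent_eq P hN0]
  refine integral_congr_ae (Eventually.of_forall fun x => ?_)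
  have h := bondCurrentZ_embed P (Nk k) (Nk k / 2) x ⟨Nk k / 2, Nat.div_lt_self hN0 one_lt_two⟩ hc
  simpa using h

end Summit.AtomisticToContinuum.FouriersLaw.Theorems.WindowLimit

end
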